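import Literature.MathematicalPhysics.QuantumLattice.YangMillsClassical
import Literature.Analysis.Calculus.AngularMomentumFields
import Mathlib.Analysis.Normed.Module.Dual
import HarnessLib

/-!
# The spherical part of the covariant Laplacian

QuantumLattice support file (everything proved; no definitions, no named facts) on the proof
path of `Literature.MathematicalPhysics.QuantumLattice.Waldron2019_yangMillsFlow_flatTorus`
(A. Waldron, Invent. math. 217 (2019)), §4: the evolution equations of the flow are written in
cylindrical coordinates, which for the flat covariant Laplacian `∑ₖ DₖDₖ` acting on sections
means the split into radial and spherical parts. With the angular-momentum fields
`L_{ij}(x) = ⟨x,bᵢ⟩bⱼ − ⟨x,bⱼ⟩bᵢ` of an orthonormal frame (`AngularMomentumFields`) and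
`D_L(D_Lφ)(x) = D_{L(x)}(y ↦ D_{L(y)}φ)(x)` (covariant derivatives along the FIELD `L`):

* `sum_sum_bilinear_angularField_vec` — the contraction identity
  `∑ᵢ∑ⱼ B(L_{ij}x, L_{ij}x) = 2(‖x‖² ∑ₖ B(bₖ,bₖ) − B(x,x))` for vector-valued bilinear `B`;
* `covDerivCLM`, `covDerivCLM_apply` — `v ↦ D_vφ(y)` as a continuous linear map;
* `covDeriv_covDeriv_angularField_apply` — `D_L(D_Lφ)(x) = D²φ(x)(Lx, Lx) + D_{L(Lx)}φ(x)` with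
  the second covariant derivative `D²φ(x)(u, v) = D_u(y ↦ D_vφ)(x)` (`v` frozen);
* `sum_sum_covDeriv_covDeriv_angularField` — **the spherical part of the covariant Laplacian**:
  `∑ᵢ∑ⱼ D_{L_{ij}}(D_{L_{ij}}φ)(x) = 2(‖x‖² ∑ₖ DₖDₖφ(x) − D²φ(x)(x, x) − (n − 1) D_xφ(x))`,
  i.e. `∑ₖDₖDₖ = D_νD_ν + ((n−1)/r)D_ν + r⁻²·½∑ᵢ∑ⱼD_{L_{ij}}²` on sections.

References: A. Waldron, Invent. math. 217 (2019), §4.1–4.2 [Waldron2019].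
-/

noncomputable section

open scoped RealInnerProductSpace Topology
open Literature.Analysis.Calculus

namespace Literature.MathematicalPhysics.QuantumLattice

section SphericalSplit

variable {E : Type*} [NormedAddCommGroup E] [InnerProductSpace ℝ E]
variable {𝔸 : Type*} [NormedRing 𝔸] [NormedAlgebra ℝ 𝔸]
variable {ι : Type*} [Fintype ι]

omit [Fintype ι] in
/-- **Contraction of a vector-valued bilinear map with the angular fields**:
`∑ᵢ∑ⱼ B(L_{ij}x, L_{ij}x) = 2(‖x‖² ∑ₖ B(bₖ,bₖ) − B(x,x))` (from the scalar case by duality).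
[folklore] -/
theorem sum_sum_bilinear_angularField_vec [Fintype ι] {F : Type*} [NormedAddCommGroup F]
    [NormedSpace ℝ F] (b : OrthonormalBasis ι ℝ E) (B : E →L[ℝ] E →L[ℝ] F) (x : E) :
    ∑ i, ∑ j, B (angularField b i j x) (angularField b i j x) =
      (2 : ℝ) • (‖x‖ ^ 2 • ∑ k, B (b k) (b k) - B x x) := by
  refine (SeparatingDual.eq_iff_forall_dual_eq (R := ℝ)).2 fun ℓ => ?_
  have h := sum_sum_bilinear_angularField b ((ContinuousLinearMap.compL ℝ E F ℝ ℓ).comp B) x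
  simp only [ContinuousLinearMap.comp_apply, ContinuousLinearMap.compL_apply] at h
  simp only [map_sum, map_smul, map_sub, smul_eq_mul]
  rw [h]

/-- **`v ↦ D_vφ(y)` as a continuous linear map**: `Dφ(y) + (R_{φ(y)} − L_{φ(y)}) ∘ A(y)`.
[folklore] -/
def covDerivCLM (A : Connection E 𝔸) (φ : E → 𝔸) (y : E) : E →L[ℝ] 𝔸 :=
  fderiv ℝ φ y +
    (((ContinuousLinearMap.mul ℝ 𝔸).flip (φ y) - ContinuousLinearMap.mul ℝ 𝔸 (φ y)).comp (A y))

/-- `covDerivCLM A φ y v = D_vφ(y)`. [folklore] -/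
theorem covDerivCLM_apply (A : Connection E 𝔸) (φ : E → 𝔸) (y v : E) :
    covDerivCLM A φ y v = covDeriv A φ y v := by
  simp [covDerivCLM, covDeriv, Ring.lie_def]

/-- Differentiability of `y ↦ covDerivCLM A φ y` at `x` for `A` differentiable at `x` and `φ`
twice differentiable at `x`. [folklore] -/
theorem differentiableAt_covDerivCLM {A : Connection E 𝔸} {φ : E → 𝔸} {x : E}
    (hA : DifferentiableAt ℝ A x) (hφ : DifferentiableAt ℝ φ x)
    (hφ2 : DifferentiableAt ℝ (fderiv ℝ φ) x) :
    DifferentiableAt ℝ (covDerivCLM A φ) x := by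
  unfold covDerivCLM
  refine hφ2.add (DifferentiableAt.clm_comp ?_ hA)
  have h1 : DifferentiableAt ℝ (fun y => (ContinuousLinearMap.mul ℝ 𝔸).flip (φ y)) x :=
    ((ContinuousLinearMap.mul ℝ 𝔸).flip).differentiableAt.comp x hφ
  have h2 : DifferentiableAt ℝ (fun y => ContinuousLinearMap.mul ℝ 𝔸 (φ y)) x :=
    (ContinuousLinearMap.mul ℝ 𝔸).differentiableAt.comp x hφ
  exact h1.sub h2

/-- **The iterated covariant derivative along the angular field** in terms of the second
covariant derivative with frozen direction: for `x`, with `L = L_{ij}`,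
`D_{L(x)}(y ↦ D_{L(y)}φ)(x) = D_{L(x)}(y ↦ D_{L(x)}φ(y))(x) + D_{L(L(x))}φ(x)` — more generally for
any linear field `T`: `D_{u}(y ↦ D_{T y}φ)(x) = D_u(y ↦ D_{T x}φ)(x) + D_{T u}φ(x)`. [folklore] -/
theorem covDeriv_covDeriv_linearField_apply {A : Connection E 𝔸} {φ : E → 𝔸} {x : E}
    (hA : DifferentiableAt ℝ A x) (hφ : DifferentiableAt ℝ φ x)
    (hφ2 : DifferentiableAt ℝ (fderiv ℝ φ) x) (T : E →L[ℝ] E) (u : E) :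
    covDeriv A (fun y => covDeriv A φ y (T y)) x u =
      covDeriv A (fun y => covDeriv A φ y (T x)) x u + covDeriv A φ x (T u) := by
  have hC := differentiableAt_covDerivCLM hA hφ hφ2
  -- rewrite both inner sections through the continuous linear map `covDerivCLM`
  have heq1 : (fun y => covDeriv A φ y (T y)) = fun y => covDerivCLM A φ y (T y) :=
    funext fun y => (covDerivCLM_apply A φ y (T y)).symm
  have heq2 : (fun y => covDeriv A φ y (T x)) = fun y => covDerivCLM A φ y (T x) :=
    funext fun y => (covDerivCLM_apply A φ y (T x)).symm
  rw [heq1, heq2]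
  unfold covDeriv
  rw [fderiv_clm_apply hC T.differentiableAt, fderiv_clm_apply hC (differentiableAt_const _),
    T.fderiv, fderiv_const_apply]
  simp only [FunLike.coe_add, Pi.add_apply, ContinuousLinearMap.comp_apply,
    ContinuousLinearMap.flip_apply, zero_apply, map_zero, zero_add, covDerivCLM_apply]
  simp only [covDeriv, Ring.lie_def]
  abel

/-- **The spherical part of the flat covariant Laplacian.** For a connection `A` differentiable
at `x`, a section `φ` twice differentiable at `x`, and an orthonormal frame `b` (`n = card ι`):
`∑ᵢ∑ⱼ D_{L_{ij}}(D_{L_{ij}}φ)(x) = 2(‖x‖² ∑ₖ D_{bₖ}(D_{bₖ}φ)(x) − D_x(D_xφ)(x) − (n−1) D_xφ(x))`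
(second derivatives with frozen inner direction), i.e. on sections
`∑ₖDₖDₖ = D_νD_ν + ((n−1)/r)D_ν + r⁻²·½∑ᵢ∑ⱼD_{L_{ij}}²`.
[cite: Waldron2019, §4.1–4.2 (the covariant Laplacian in cylindrical coordinates)] -/
theorem sum_sum_covDeriv_covDeriv_angularField [DecidableEq ι] (b : OrthonormalBasis ι ℝ E)
    {A : Connection E 𝔸} {φ : E → 𝔸} {x : E} (hA : DifferentiableAt ℝ A x)
    (hφ : DifferentiableAt ℝ φ x) (hφ2 : DifferentiableAt ℝ (fderiv ℝ φ) x) :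
    ∑ i, ∑ j, covDeriv A (fun y => covDeriv A φ y (angularField b i j y)) x (angularField b i j x) =
      (2 : ℝ) • (‖x‖ ^ 2 • ∑ k, covDeriv A (fun y => covDeriv A φ y (b k)) x (b k) -
        covDeriv A (fun y => covDeriv A φ y x) x x -
        ((Fintype.card ι : ℝ) - 1) • covDeriv A φ x x) := by
  have hC := differentiableAt_covDerivCLM hA hφ hφ2
  -- the second covariant derivative with frozen inner direction, as a bilinear map
  set Bf : E → E → 𝔸 := fun u v => covDeriv A (fun y => covDeriv A φ y v) x u with hBf
  have hBf_eq : ∀ u v, Bf u v = fderiv ℝ (covDerivCLM A φ) x u v + ⁅A x u, covDerivCLM A φ x v⁆ := by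
    intro u v
    simp only [hBf]
    have heq : (fun y => covDeriv A φ y v) = fun y => covDerivCLM A φ y v :=
      funext fun y => (covDerivCLM_apply A φ y v).symm
    rw [heq]
    unfold covDeriv
    rw [fderiv_clm_apply hC (differentiableAt_const _), fderiv_const_apply]
    simp only [FunLike.coe_add, Pi.add_apply, ContinuousLinearMap.comp_apply,
      ContinuousLinearMap.flip_apply, zero_apply, map_zero, zero_add]
  -- `Bf` is bilinear: realize it as a continuous bilinear map
  set C : E →L[ℝ] 𝔸 := covDerivCLM A φ x with hCdef
  set M : 𝔸 →L[ℝ] 𝔸 →L[ℝ] 𝔸 := ContinuousLinearMap.mul ℝ 𝔸 with hM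
  set Bc : E →L[ℝ] E →L[ℝ] 𝔸 := fderiv ℝ (covDerivCLM A φ) x +
    (((ContinuousLinearMap.compL ℝ E 𝔸 𝔸).flip C).comp (M.comp (A x)) -
      ((ContinuousLinearMap.compL ℝ E 𝔸 𝔸).flip C).comp (M.flip.comp (A x))) with hBc
  have hBc_apply : ∀ u v, Bc u v = Bf u v := by
    intro u v
    rw [hBf_eq]
    simp only [hBc, hM, hCdef, FunLike.coe_add, FunLike.coe_sub, Pi.add_apply, Pi.sub_apply,
      ContinuousLinearMap.comp_apply, ContinuousLinearMap.flip_apply,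
      ContinuousLinearMap.compL_apply, ContinuousLinearMap.mul_apply', Ring.lie_def]
  -- the angular fields as continuous linear maps
  have hT : ∀ i j, ∃ T : E →L[ℝ] E, ∀ y, angularField b i j y = T y := fun i j =>
    ⟨(innerSL ℝ (b i)).smulRight (b j) - (innerSL ℝ (b j)).smulRight (b i),
      fun y => angularField_eq_clm b i j y⟩
  -- ### each term: `D_L(D_Lφ) = Bf(Lx, Lx) + D_{L(Lx)}φ`
  have hterm : ∀ i j, covDeriv A (fun y => covDeriv A φ y (angularField b i j y)) x
      (angularField b i j x) =
      Bc (angularField b i j x) (angularField b i j x) +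
        covDeriv A φ x (angularField b i j (angularField b i j x)) := by
    intro i j
    obtain ⟨T, hTy⟩ := hT i j
    have hfun : (fun y => covDeriv A φ y (angularField b i j y)) =
        fun y => covDeriv A φ y (T y) := funext fun y => by rw [hTy y]
    rw [hfun, hTy x, hTy (T x), covDeriv_covDeriv_linearField_apply hA hφ hφ2 T (T x), hBc_apply]
  simp_rw [hterm]
  rw [Finset.sum_congr rfl fun i _ => Finset.sum_add_distrib, Finset.sum_add_distrib,
    sum_sum_bilinear_angularField_vec b Bc x]
  -- ### the first-order terms: linearity of `v ↦ D_vφ(x)` and `∑ᵢ∑ⱼ L(Lx) = −2(n−1)x`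
  have hlin : ∑ i, ∑ j, covDeriv A φ x (angularField b i j (angularField b i j x)) =
      covDeriv A φ x (∑ i, ∑ j, angularField b i j (angularField b i j x)) := by
    simp only [← covDerivCLM_apply A φ x, map_sum]
  rw [hlin, sum_sum_angularField_angularField b x, ← covDerivCLM_apply A φ x, map_smul,
    covDerivCLM_apply, hBc_apply, Finset.sum_congr rfl fun k _ => hBc_apply (b k) (b k)]
  simp only [hBf]
  module

end SphericalSplit

end Literature.MathematicalPhysics.QuantumLattice
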